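import Summits.QuantumFields.BalabanUV.T4Continuum.Support.NE7EtaBackgroundRefineDischarge
import Summits.QuantumFields.BalabanUV.T4Continuum.Support.NE3ClassRadiusFamily
import HarnessLib

/-!
# NE7EtaBackgroundLevelSmallDischarge — route #1 of the NE7 crux, stub S7 (NODE O, the BACKGROUND COORDINATE): the K-indexed smallness
# family `hls : ∀ j, LevelSmall 4 L j (ε ∕ (L^{j+1})²)` of the `hclose` chain DISCHARGED BY NAME from ONE closed-form numeric line

Cell `pub-balaban`, rung (B)+1 sub-cell t4, lineage `b2b-balaban-t4-ne7-p1`, generation 51 (CRUX PROVER NE7 #1, ruling e34b3e0c (2)); crux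
skeleton `t4/skeletons/NE7-CRUX-R1.md` v1.7.11 §0bis item 7 ∕ §5 (G5).  HONEST FRAMING (page 1): FIXED FINITE T⁴, rung (B)+1; NE7, NE3 NOT
PRINTED in [Balaban1984PropagatorsI]–[Balaban1989LargeFieldII] and NOT PROVED here; continuum YM on T⁴ ⇐ BetaPertH ∧ nine spine estimates
(0/9 proved); BetaPertH ⇐ (D1) ∧ (D4) ∧ CAP+tail; G-an2-4 gates asym, D1 and NE2/3/4; NOT infinite volume, NOT mass gap, NOT Clay.

WHAT ([folklore]; 0 def; 0 sorry).  The background coordinate's `hclose` binder (`NE7EtaBackgroundCloseness.hclose_of_covRoot` p258604 →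
`…GaugeLetterDischarge.hclose_of_refine_regular` p263433 → `…RefineDischarge.hclose_of_regularSup` p266066) and its docking
`NE7EtaBackgroundTowerRate.uRateUpTo_bgCarriers_of_covRoot` (p259051) all carry the K-INDEXED numeric family
`hls : ∀ j : ℕ, LevelSmall 4 L j (ε ∕ ((L : ℝ)^(j+1))²)` («K-free `LevelSmall`»).  The NE3 crew's `NE3ClassRadiusFamily.levelSmall_family`
(leaf-05) turns the SHIFTED family `∀ j, LevelSmall d L (j+1) (ε ∕ (L^{j+2})²)` into TWO level-free lines, `16·c₁·ε ≤ 3` (`c₁ = 14464(d+1)²(d+4)²`)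
and `2·twoLevelSmall d L·ε ≤ L²`.  Here:
 * **`levelSmall_hls`** (any `d`, `L ≥ 2`, `ε ≥ 0`): the UNSHIFTED family `∀ j, LevelSmall d L j (ε ∕ (L^{j+1})²)` from the chain's OWN letter
   `16·C0 d·ε ≤ 3` (`B7Prop2Explicit.C0 d = 226·(8(d+1)(d+4))² = 14464(d+1)²(d+4)²`, `C0_eq`) and the ONE new closed-form line
   `2·twoLevelSmall d L·ε ≤ L²` (`twoLevelSmall 4 L = 104 857 600·L⁸`): level `0` is the definition of `LevelSmall … 0`, levels `j+1` are the crew's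
   family verbatim.
 * **`hclose_of_regularSup_lines`** = `NE7EtaBackgroundRefineDischarge.hclose_of_regularSup` (p266066) WITH `hls` DISCHARGED: the same statement with
   the family binder replaced by `h2line : 2·twoLevelSmall 4 L·ε ≤ L²` (its partner `hε1 : 16·C0 4·ε ≤ 3` was already a binder); ONE CALL.
CONSEQUENCE FOR THE BILL (skeleton §0bis item 7): NODE O's `hclose` binder now costs EXACTLY row NE3's covariant root `h` (amendment 4, VERBATIM;
X-A4), row NE3's (H3ˢᵘᵖ) `h3` ([Balaban1985Variational] Thm 1 (8)+(10) TYPE), the data class, CLOSED-FORM numeric letters only (`2^91·L^17·t ≤ 1`,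
`2^76·L^12·t ≤ ε`, `16·C₀·ε ≤ 3`, `40960·L²·ε ≤ 1`, `2·twoLevelSmall 4 L·ε ≤ L²`), `hdom`, `hγ3`∕`hΛl₁`, and the sector condition — no
level-indexed hypothesis is left.  Nothing in the ask of NE3, nothing in the composition changes; route 1 stays KERNEL-COMPLETE AT FORM LEVEL ∕
DEPENDENT; NE7 NOT proved.  HONEST: bookkeeping; the discharged binder is NUMERIC, not an estimate of Bałaban's; 0 def; 0 sorry.
-/

set_option autoImplicit false

open scoped BigOperators Matrix Matrix.Norms.L2Operator
open Finset NormedSpace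

namespace Summit.QuantumFields.BalabanUV.T4Continuum.NE7EtaBackgroundLevelSmallDischarge

open Literature.MathematicalPhysics.QuantumFieldTheory.Balaban1983to89
open B7Prop1Explicit B7Prop2Explicit
open T4AveragingDeficitWall hiding Site Plane Plaq Bond
open T4AveragingDeficitWallBoundary (periodBox IsPeriodicCfg)
open MinimalActionSandwich (IsMinimiser)
open MinimalActionRate (Regular sfClass)
open MinimalActionRefine (RegularSup gradConst gradConst_nonneg)
open T4OutputRate (Carriers)
open AveragingDeficitPeriodicCounting (IsPeriodicDir)
open AveragingDeficitTwoLevelPrep (twoLevelSmall)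
open AveragingDeficitMultiLevelPrep (LevelSmall)
open NE3EnergyShapes (residualScale IsUnitarySite IsPeriodicSite)
open NE3EnergyWeightedShapes (energyNormW)
open AveragingDeficitDualResidual (dualC1 dualC2)
open AveragingDeficitDerivWallProof (wallConst)
open NE7EtaBackgroundCarrier NE7EtaBackgroundCloseness
open TorusSmallFieldGlobalGauge (sectorConst gaugeConst)
open NE7EtaBackgroundRefineDischarge (hclose_of_regularSup)
open NE3ClassRadiusFamily (levelSmall_family)

noncomputable section

/-! ## §1 The unshifted `LevelSmall` family from two closed-form lines -/

/-- `B7Prop2Explicit.C0 d = 14464(d+1)²(d+4)²` — the chain's letter `16·C0 d·ε ≤ 3` IS the first line of `NE3ClassRadiusFamily.levelSmall_family`.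
[folklore] -/
theorem C0_eq (d : ℕ) : C0 d = 14464 * ((d : ℝ) + 1) ^ 2 * ((d : ℝ) + 4) ^ 2 := by
  unfold C0; ring

/-- **THE UNSHIFTED FAMILY `∀ j, LevelSmall d L j (ε ∕ (L^{j+1})²)` FROM TWO LEVEL-FREE LINES** (`L ≥ 2`, `ε ≥ 0`): `16·C0 d·ε ≤ 3` and
`2·twoLevelSmall d L·ε ≤ L²`.  Level `0` reads `twoLevelSmall·(ε∕L²) ≤ 1` (the definition); level `j+1` is `levelSmall_family … j` (radius
`ε∕(L^{j+2})²`). [folklore] -/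
theorem levelSmall_hls {d L : ℕ} (hL : 2 ≤ L) {ε : ℝ} (hε : 0 ≤ ε) (hε1 : 16 * C0 d * ε ≤ 3)
    (h2 : 2 * twoLevelSmall d L * ε ≤ (L : ℝ) ^ 2) :
    ∀ j : ℕ, LevelSmall d L j (ε / ((L : ℝ) ^ (j + 1)) ^ 2) := by
  have h1 : 16 * (14464 * ((d : ℝ) + 1) ^ 2 * ((d : ℝ) + 4) ^ 2) * ε ≤ 3 := by rw [← C0_eq]; exact hε1
  intro j
  cases j with
  | zero =>
      show twoLevelSmall d L * (ε / ((L : ℝ) ^ (0 + 1)) ^ 2) ≤ 1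
      have hL0 : (0 : ℝ) < L := by exact_mod_cast (show 0 < L by omega)
      have hL2 : (0 : ℝ) < (L : ℝ) ^ 2 := by positivity
      have hT : 0 ≤ twoLevelSmall d L := by unfold twoLevelSmall; positivity
      rw [zero_add, pow_one, ← mul_div_assoc, div_le_one hL2]
      nlinarith
  | succ j =>
      simpa using levelSmall_family (d := d) hL hε h1 h2 j

/-! ## §2 The `hclose` binder with the family discharged (`d = 4`) -/

variable {n : Type} [Fintype n] [DecidableEq n] [Nonempty n]

/-- **NODE O's `hclose` BINDER WITH THE `LevelSmall` FAMILY DISCHARGED** — `NE7EtaBackgroundRefineDischarge.hclose_of_regularSup` (p266066) with its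
binder `hls : ∀ j, LevelSmall 4 L j (ε ∕ (L^{j+1})²)` REPLACED by the closed-form line `h2line : 2·twoLevelSmall 4 L·ε ≤ L²` (`levelSmall_hls` with
the binder `hε1` already present; `0 ≤ ε` from `0 ≤ b ≤ t` and `2^76·L^12·t ≤ ε`).  Every other hypothesis and the conclusion VERBATIM those of
p266066: row NE3's covariant root `h` (amendment 4) and (H3ˢᵘᵖ) `h3` remain HYPOTHESES asserted for no configuration. [folklore] -/
theorem hclose_of_regularSup_lines {L N : ℕ} (hL : 2 ≤ L) (hN : 1 ≤ N) {θ : ℝ} (hθ : 0 < θ)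
    (hθ6 : θ ^ 6 = ((L : ℝ))⁻¹) {ε ε₁ b c t : ℝ} (hb : 0 ≤ b) (hc : 0 ≤ c) (hbt : b ≤ t) (hct : c ≤ t)
    (hsmall : (2 : ℝ) ^ 91 * (L : ℝ) ^ 17 * t ≤ 1) (hεt : (2 : ℝ) ^ 76 * (L : ℝ) ^ 12 * t ≤ ε)
    (hε1 : 16 * C0 4 * ε ≤ 3) (hε2 : 1024 * (4 + 1) * (4 + 4) * (L : ℝ) ^ 2 * ε ≤ 1)
    (h2line : 2 * twoLevelSmall 4 L * ε ≤ (L : ℝ) ^ 2)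
    (hε₁ : ε₁ ≤ 1 / 4) (hε₁b : ε₁ ≤ b) (hε₁c : 4 * ε₁ ≤ c)
    {g C Λ₁ Λ₂' : ℝ} (hgc : gradConst 4 c ≤ g) (hC : 0 ≤ C) (hΛ₂' : 0 < Λ₂')
    {dom : Set (Site 4 → Fin 4 → (Matrix n n ℂ)ˣ)} (hdom1 : dom ⊆ sfClass 4 L N ε₁ 0)
    (hdom : ∀ v ∈ dom, ∀ w : Site 4 → (Matrix n n ℂ)ˣ, IsUnitarySite w → IsPeriodicSite w (N : ℤ) → gaugeAct w v ∈ dom)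
    (h3 : ∀ V ∈ dom, ∀ (k : ℕ) (U : Site 4 → Fin 4 → (Matrix n n ℂ)ˣ),
      IsMinimiser 4 (sfClass 4 L N ε) L N (k + 1) V U → RegularSup 4 L N b c (k + 1) U)
    (h : ∀ k : ℕ, 1 ≤ k → ∀ V ∈ dom, ∀ UA UB : Site 4 → Fin 4 → (Matrix n n ℂ)ˣ,
      IsMinimiser 4 (sfClass 4 L N ε) L N k V UA → IsMinimiser 4 (sfClass 4 L N ε) L N (k + 1) V UB →
        Regular 4 L N b g (k + 1) UB →
        ∃ (u : Site 4 → (Matrix n n ℂ)ˣ) (Z : Site 4 → Fin 4 → Matrix n n ℂ),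
          IsUnitarySite u ∧ IsPeriodicSite u ((N * L ^ k : ℕ) : ℤ) ∧
          IsSkewDir Z ∧ IsPeriodicDir Z ((N * L ^ k : ℕ) : ℤ) ∧
          gaugeAct u UA = vary (rescale L (bavg L UB)) Z 1 ∧
          energyNormW L k (rescale L (bavg L UB)) Z (periodBox (N * L ^ k)) ≤ C * residualScale 4 L N b g k ∧
          (∀ (κ : Fin 4) (x : Site 4) (μ : Fin 4),
            ‖Ad (rescale L (bavg L UB) (x + e κ) μ) (Z (x + e μ) κ) - Z x κ‖ ≤ Λ₁ * (((L : ℝ)⁻¹) ^ k) ^ 2) ∧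
          (∀ (κ μ : Fin 4) (y : Site 4),
            ‖Ad (rescale L (bavg L UB) (y + e κ) μ)
                (Ad (rescale L (bavg L UB) (y + e κ + e μ) μ) (Z (y + (2 : ℕ) • e μ) κ) - Z (y + e μ) κ)
              - (Ad (rescale L (bavg L UB) (y + e κ) μ) (Z (y + e μ) κ) - Z y κ)‖ ≤ Λ₂' * (((L : ℝ)⁻¹) ^ k) ^ 3))
    {γ l₁ : ℝ} (hγ : 0 < γ)
    (hγ3 : C * (wallConst 4 L * (N : ℝ) ^ 2 * (Real.sqrt g * dualC2 4 L + 2 * b ^ 2 * dualC1 4 L)) ≤ γ ^ 3)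
    (hl₁ : 0 < l₁) (hΛl₁ : Λ₁ ≤ l₁ ^ 3)
    (hsector : (Fintype.card n : ℝ) * (N : ℝ) ^ 2 * ε ≤ sectorConst n)
    (D : Type) (sc : D → ℕ) (dl : D → ℝ) (hdl : ∀ X, 0 ≤ dl X) :
    ∃ (uA : ℕ → (Site 4 → Fin 4 → (Matrix n n ℂ)ˣ) → (occCarriers n L N ε dom D sc dl hdl).BgA)
      (uB : ℕ → (Site 4 → Fin 4 → (Matrix n n ℂ)ˣ) → (occCarriers n L N ε dom D sc dl hdl).BgB) (K₀ : ℕ) (C₃ : ℝ),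
      0 ≤ C₃ ∧
      (∀ K : ℕ, K₀ ≤ K → ∀ v ∈ dom, ∃ (UA UB : Site 4 → Fin 4 → (Matrix n n ℂ)ˣ) (wA wB : Site 4 → (Matrix n n ℂ)ˣ),
        IsMinimiser 4 (sfClass 4 L N ε) L N K v UA ∧ IsMinimiser 4 (sfClass 4 L N ε) L N (K + 1) v UB ∧
        Regular 4 L N b g (K + 1) UB ∧ IsUnitarySite wA ∧ IsPeriodicSite wA ((N * L ^ K : ℕ) : ℤ) ∧
        IsUnitarySite wB ∧ IsPeriodicSite wB ((N * L ^ (K + 1) : ℕ) : ℤ) ∧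
        (uA K v).1 = (K, gaugeAct wA UA) ∧ (uB K v).1 = (K, gaugeAct wB UB)) ∧
      (∀ (K : ℕ) (v : Site 4 → Fin 4 → (Matrix n n ℂ)ˣ), ¬ (K₀ ≤ K ∧ v ∈ dom) →
        (uA K v).1 = (K, 1) ∧ (uB K v).1 = (K, 1)) ∧
      ∀ K : ℕ, ∀ v ∈ dom, (occCarriers n L N ε dom D sc dl hdl).gauge (uA K v)
          ((occCarriers n L N ε dom D sc dl hdl).transport (uB K v))
        ≤ C₃ * θ ^ K := by
  have hε : 0 ≤ ε := le_trans (by positivity) (le_trans (mul_le_mul_of_nonneg_left (hb.trans hbt) (by positivity)) hεt)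
  exact hclose_of_regularSup hL hN hθ hθ6 hb hc hbt hct hsmall hεt hε1 hε2 (levelSmall_hls hL hε hε1 h2line) hε₁ hε₁b hε₁c hgc hC
    hΛ₂' hdom1 hdom h3 h hγ hγ3 hl₁ hΛl₁ hsector D sc dl hdl

end

end Summit.QuantumFields.BalabanUV.T4Continuum.NE7EtaBackgroundLevelSmallDischarge
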